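import HarnessLib
import Summits.Ventures.WeilGRH.UniformConductorFloorPrincipal
import Summits.Ventures.WeilGRH.OneCompleteMod29
import Summits.Ventures.WeilGRH.DualTrigCertMod29Class2One
import Summits.Ventures.WeilGRH.DualTrigCertMod29Class3One
import Summits.Ventures.WeilGRH.DualTrigCertMod29Class8One
import Summits.Ventures.WeilGRH.DualTrigCertMod29Class12One
import Summits.Ventures.WeilGRH.DualTrigCertMod29Class14One
import Summits.Ventures.WeilGRH.DualTrigCertMod29Class18One
import Summits.Ventures.WeilGRH.DualTrigCertMod29Class19One

/-!
# GRH arm (rh-explicit, venture WeilGRH): Weil positivity on `[−1, 1]` for EVERY non-principal Dirichlet character mod 29 — the complete level 29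

Cell `rh-explicit`, WEIL TRACK — GRH ARM (seat weil-grh-1 gen12; pure assembly of landed theorems of weil-grh-2 (even side) and weil-grh-3 (odd side)).
`(ℤ/29)ˣ = ⟨2⟩` is cyclic of order 28, so `χ(2) = ζ^i` with `ζ = exp(2πi/28)`, `i < 28`, and `χ(−1) = χ(2)^14 = (−1)^i`.
* EVEN non-principal characters (`i` even, `i ≠ 0`): `OneCompleteMod29.weilPositivityOnChar_mod29_one_of_even` (door-C cells + the real island).
* ODD characters (`i` odd): the fourteen format-D-K certificates of weil-grh-3, one per character, filed as seven classes with their conjugates: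
  `weilPositivityOnChar_mod29_class2_one` (`i = 1`) / `class8` (`3`) / `class3` (`5`) / `class12` (`7`, printed as `1/4`) / `class19` (`9`) / `class18` (`11`) /
  `class14` (`13`, via its `(log 8)/2` rung) and the `_conj` twins (`i = 27, 25, 23, 21, 19, 17, 15`, printed with negative fractions).
Since `29 ∈ F` (the principal character fails on `[−1, 1]` by weil-grh-1's flat-window witness), the level is decided exactly: `WeilPositivityOnChar χ 1 ↔ χ ≠ 1`.
Pure assembly; RH/GRH-free; standard axioms.
-/

noncomputable section

namespace Summit.Ventures.WeilGRH.OneCompleteMod29All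
open Literature.NumberTheory.LFunctions
open scoped Real

/-- Powers of `ζ = exp(2πi/28)` in the printed form of the class files: `ζ^k = exp(2πi·(k + 28 n)/28)` for every integer shift `n`. [folklore] -/
theorem zeta28_pow_eq_exp {k : ℕ} {r : ℂ} (n : ℤ) (hr : (k : ℂ) / 28 = r + n) :
    (Complex.exp (2 * ↑Real.pi * Complex.I / 28)) ^ k = Complex.exp (2 * Real.pi * Complex.I * r) := by
  rw [← Complex.exp_nat_mul, Complex.exp_eq_exp_iff_exists_int]
  refine ⟨n, ?_⟩
  have : (k : ℂ) = 28 * r + 28 * n := by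
    have h := congrArg (fun z : ℂ ↦ 28 * z) hr
    simp only [mul_div_cancel₀ _ (by norm_num : (28 : ℂ) ≠ 0), mul_add] at h
    exact h
  rw [this]; ring

/-- ★★ **Every non-principal Dirichlet character mod 29 satisfies Weil positivity on `[−1, 1]`.**
[cite: Weil1952FormulesExplicites, (11) pp. 261–262 and the «lemme» p. 262] -/
theorem weilPositivityOnChar_mod29_one (χ : DirichletCharacter ℂ 29) (hχ : χ ≠ 1) : WeilPositivityOnChar χ 1 := by
  rcases χ.even_or_odd with he | ho
  · exact OneCompleteMod29.weilPositivityOnChar_mod29_one_of_even χ hχ he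
  · have hz : χ (2 : ZMod 29) ^ 28 = 1 := by
      rw [← map_pow, show (2 : ZMod 29) ^ 28 = 1 from by decide +kernel, map_one]
    have hprim : IsPrimitiveRoot (Complex.exp (2 * ↑Real.pi * Complex.I / 28)) 28 := by
      exact_mod_cast Complex.isPrimitiveRoot_exp 28 (by norm_num)
    obtain ⟨i, hi, hiz⟩ := hprim.eq_pow_of_pow_eq_one hz
    have hm1 : χ (-1) = (Complex.exp (2 * ↑Real.pi * Complex.I / 28)) ^ (i * 14) := by
      rw [pow_mul, hiz, ← map_pow, show (2 : ZMod 29) ^ 14 = -1 from by decide +kernel]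
    have ho1 : χ (-1) = -1 := ho
    -- oddness forces `i` odd: for even `i`, `χ(−1) = ζ^{14 i} = (ζ^{28})^{i/2} = 1`
    have hodd : ¬ 2 ∣ i := by
      rintro ⟨m, rfl⟩
      rw [hm1, show 2 * m * 14 = 28 * m from by ring, pow_mul, hprim.pow_eq_one, one_pow] at ho1
      norm_num at ho1
    -- `χ 2 = exp(2πi·r)` in the printed normalisation of the class files, from `ζ^i = χ 2`
    have key : ∀ {r : ℂ} (n : ℤ), (i : ℂ) / 28 = r + n → χ (2 : ZMod 29) = Complex.exp (2 * Real.pi * Complex.I * r) :=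
      fun n hr ↦ by rw [← hiz]; exact zeta28_pow_eq_exp n hr
    interval_cases i
    · exact absurd (by norm_num) hodd
    · exact weilPositivityOnChar_mod29_class2_one χ (key 0 (by push_cast; ring))
    · exact absurd (by norm_num) hodd
    · exact weilPositivityOnChar_mod29_class8_one χ (key 0 (by push_cast; ring))
    · exact absurd (by norm_num) hodd
    · exact weilPositivityOnChar_mod29_class3_one χ (key 0 (by push_cast; ring))
    · exact absurd (by norm_num) hodd
    · exact weilPositivityOnChar_mod29_class12_one χ (key 0 (by push_cast; ring))
    · exact absurd (by norm_num) hodd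
    · exact weilPositivityOnChar_mod29_class19_one χ (key 0 (by push_cast; ring))
    · exact absurd (by norm_num) hodd
    · exact weilPositivityOnChar_mod29_class18_one χ (key 0 (by push_cast; ring))
    · exact absurd (by norm_num) hodd
    · exact weilPositivityOnChar_mod29_class14_one χ (key 0 (by push_cast; ring))
    · exact absurd (by norm_num) hodd
    · exact weilPositivityOnChar_mod29_class14_one_conj χ (key 1 (by push_cast; ring))
    · exact absurd (by norm_num) hodd
    · exact weilPositivityOnChar_mod29_class18_one_conj χ (key 1 (by push_cast; ring))
    · exact absurd (by norm_num) hodd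
    · exact weilPositivityOnChar_mod29_class19_one_conj χ (key 1 (by push_cast; ring))
    · exact absurd (by norm_num) hodd
    · exact weilPositivityOnChar_mod29_class12_one_conj χ (key 1 (by push_cast; ring))
    · exact absurd (by norm_num) hodd
    · exact weilPositivityOnChar_mod29_class3_one_conj χ (key 1 (by push_cast; ring))
    · exact absurd (by norm_num) hodd
    · exact weilPositivityOnChar_mod29_class8_one_conj χ (key 1 (by push_cast; ring))
    · exact absurd (by norm_num) hodd
    · exact weilPositivityOnChar_mod29_class2_one_conj χ (key 1 (by push_cast; ring))

/-- ★★ **At level 29 EXACTLY the principal character fails Weil positivity on `[−1, 1]`**: for every Dirichlet character `χ` mod 29,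
`WeilPositivityOnChar χ 1 ↔ χ ≠ 1` (the principal character fails by the flat-window witness of
`UniformFloor.not_weilPositivityOnChar_one_principal`, `29 ∈ F`). [cite: Weil1952FormulesExplicites, (11) pp. 261–262 and the «lemme» p. 262] -/
theorem weilPositivityOnChar_one_iff_ne_one_mod29 (χ : DirichletCharacter ℂ 29) : WeilPositivityOnChar χ 1 ↔ χ ≠ 1 :=
  ⟨fun h h1 ↦ UniformFloor.not_weilPositivityOnChar_one_principal (q := 29) (by decide) (h1 ▸ h), weilPositivityOnChar_mod29_one χ⟩

/-- Every non-principal character mod 29 is Weil-positive on every window `[−t, t]`, `t ≤ 1`. [folklore] -/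
theorem weilPositivityOnChar_of_le_one_mod29 (χ : DirichletCharacter ℂ 29) (hχ : χ ≠ 1) {t : ℝ} (ht : t ≤ 1) :
    WeilPositivityOnChar χ t := fun g hg hsupp ↦
  weilPositivityOnChar_mod29_one χ hχ g hg (hsupp.trans (Set.Icc_subset_Icc (by linarith) ht))

end Summit.Ventures.WeilGRH.OneCompleteMod29All

end
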